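import Summits.QuantumAdvantage.QuantumAdvantage.Theorems.IqThreeNotPPoly.Negative.RefutationShape
import Literature.NumberTheory.QuadraticFields.AmbiguousClasses
import Literature.NumberTheory.QuadraticFields.DedekindZetaReducedForms
import Literature.NumberTheory.QuadraticFields.FundamentalDiscriminant

/-!
# `IqThreeNotPPoly` (stmt-QuantumAdvantage-2422) — genus theory for the `ℓ = 2` mutation: parity of `h(−d)`

Negative-side lemmas for the crux `ArithStatLadder.IqThreeNotPPoly`, extracted from the refuter work
file `Summits/QuantumAdvantage/QuantumAdvantage/Cruxes/IqThreeNotPPoly/Disproof.lean`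
(refuter-cdisprove-stmt-QuantumAdvantage-2422-0, cycle 1); first of two files on the MUTATION
`3 ↦ 2` (the second, `GenusTwoCollapse.lean`, turns this into the `P/poly` statement
`IQ2 ∉ P/poly ↔ bin {−d fundamental} ∉ P/poly`). Sorry-free; axioms ⊆ {propext, Classical.choice,
Quot.sound}. No statement of the route is asserted positively.

Content: Gauss's genus theory `|Cl_K[2]| = 2^{t−1}` (tree theorem `card_sq_eq_one_classGroup`,
restated with the hypotheses `[K:ℚ] = 2`, `d_K < 0`: `card_sq_eq_one_of_discr_neg`) and Cauchy give
the parity of the class number of a quadratic field with negative discriminant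
(`two_dvd_card_classGroup_iff`); through the PROVED bridge `h(d_K) = h_K`
(`card_reducedForms_eq_classNumber`) and the existence of a quadratic field of every fundamental
discriminant (`exists_numberField_discr_eq`) this becomes, for fundamental `−d`,
`2 ∣ h(−d) ↔ ω(d) ≥ 2 ↔ ¬ (d = 4 ∨ d = 8 ∨ d prime)` (`two_dvd_classNumber_iff`,
`two_dvd_classNumber_iff_not`), whence the set identities `iqTwoSet_eq`
(`IQ2-set = Fund ∖ ({4, 8} ∪ primes)`) and `fundSet_eq` (`Fund = IQ2-set ∪ {4, 8} ∪ primes ≡ 3 (4)`).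
-/

noncomputable section

namespace Summit.QuantumAdvantage.QuantumAdvantage.Theorems.IqThreeNotPPoly.Negative

open Literature.Computability.Cryptography
open Literature.NumberTheory.QuadraticFields
open Module NumberField

/-! ### Genus theory: parity of the class number of an imaginary quadratic field -/

section Field

variable {K : Type*} [Field K] [NumberField K]

/-- `|Cl_K[2]| = 2^{t−1}` for a quadratic field with negative discriminant (the tree's
`card_sq_eq_one_classGroup`, with the hypotheses `[K:ℚ] = 2`, `d_K < 0` in place of
`IsImaginaryQuadratic K`). [folklore] -/
theorem card_sq_eq_one_of_discr_neg (h2 : finrank ℚ K = 2) (hneg : NumberField.discr K < 0) :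
    Nat.card {c : ClassGroup (𝓞 K) // c ^ 2 = 1} =
      2 ^ ((NumberField.discr K).natAbs.primeFactors.card - 1) := by
  obtain ⟨b, hb⟩ := Quadratic.exists_basis_zero_eq_one (K := K) h2
  have hω := Quadratic.basis_one_mul_self_eq b hb
  have hDK := Quadratic.discr_eq_sq_add_four_mul b hb
  have hneg' : (b.repr (b 1 * b 1) 1) ^ 2 + 4 * b.repr (b 1 * b 1) 0 < 0 := hDK ▸ hneg
  rw [Quadratic.card_sq_eq_one_eq_card_filter_ambiguous b hb hω hneg', ← hDK]
  exact Quadratic.card_filter_ambiguous_reducedForms_discr h2 hneg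

/-- **Parity of the class number** of a quadratic field with `d_K < 0`: `h_K` is even iff `d_K`
has at least two prime divisors (Gauss's genus theory: `|Cl_K[2]| = 2^{t−1}`, plus Cauchy).
[folklore] -/
theorem two_dvd_card_classGroup_iff (h2 : finrank ℚ K = 2) (hneg : NumberField.discr K < 0) :
    2 ∣ Fintype.card (ClassGroup (𝓞 K)) ↔ 2 ≤ (NumberField.discr K).natAbs.primeFactors.card := by
  have hc := card_sq_eq_one_of_discr_neg h2 hneg
  haveI : Fact (Nat.Prime 2) := ⟨Nat.prime_two⟩
  constructor
  · intro hdvd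
    by_contra hlt
    have ht : (NumberField.discr K).natAbs.primeFactors.card - 1 = 0 := by omega
    rw [ht, pow_zero] at hc
    obtain ⟨x, hx⟩ := exists_prime_orderOf_dvd_card 2 hdvd
    have hx2 : x ^ 2 = 1 := by rw [← hx]; exact pow_orderOf_eq_one x
    have hsub := (Nat.card_eq_one_iff_unique.1 hc).1
    have h1 : (⟨x, hx2⟩ : {c : ClassGroup (𝓞 K) // c ^ 2 = 1}) = ⟨1, one_pow 2⟩ :=
      Subsingleton.elim _ _
    have hx1 : x = 1 := congrArg Subtype.val h1
    rw [hx1, orderOf_one] at hx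
    exact absurd hx (by norm_num)
  · intro ht
    have h2le : 1 < Nat.card {c : ClassGroup (𝓞 K) // c ^ 2 = 1} := by
      rw [hc]
      calc 1 < 2 ^ 1 := by norm_num
        _ ≤ 2 ^ ((NumberField.discr K).natAbs.primeFactors.card - 1) :=
          Nat.pow_le_pow_right (by norm_num) (by omega)
    haveI := Finite.one_lt_card_iff_nontrivial.1 h2le
    obtain ⟨a, b, hab⟩ := exists_pair_ne {c : ClassGroup (𝓞 K) // c ^ 2 = 1}
    obtain ⟨c, hc1⟩ : ∃ c : {c : ClassGroup (𝓞 K) // c ^ 2 = 1}, c.1 ≠ 1 := by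
      by_cases ha : a.1 = 1
      · exact ⟨b, fun hb1 => hab (Subtype.ext (ha.trans hb1.symm))⟩
      · exact ⟨a, ha⟩
    have hord : orderOf c.1 = 2 := orderOf_eq_prime c.2 hc1
    rw [← hord]
    exact orderOf_dvd_card

end Field

/-! ### Form level: `2 ∣ h(−d)` for fundamental `−d` -/

/-- A negative fundamental discriminant `−d` has `d > 0`. [folklore] -/
theorem pos_of_isNegFundamentalDiscr {d : ℕ} (hF : IsNegFundamentalDiscr d) : 0 < d := by
  rcases hF with ⟨h1, -, -⟩ | ⟨-, h2, -⟩
  · omega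
  · rcases Nat.eq_zero_or_pos d with rfl | hd
    · norm_num at h2
    · exact hd

/-- **`2 ∣ h(−d)` iff `d` has at least two prime factors**, for a fundamental `−d` (genus
theory through the tree's `card_sq_eq_one_classGroup`, the PROVED bridge `h(d_K) = h_K` and the
existence of a quadratic field of every fundamental discriminant). [folklore] -/
theorem two_dvd_classNumber_iff {d : ℕ} (hF : IsNegFundamentalDiscr d) :
    2 ∣ BinaryQuadraticForm.classNumber (-(d : ℤ)) ↔ 2 ≤ d.primeFactors.card := by
  obtain ⟨K, _, _, h2, hdisc⟩ := Quadratic.exists_numberField_discr_eq (D := -(d : ℤ)) hF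
  have hd0 := pos_of_isNegFundamentalDiscr hF
  have hneg : NumberField.discr K < 0 := by rw [hdisc]; omega
  have hbridge := Quadratic.card_reducedForms_eq_classNumber h2 hneg
  rw [hdisc] at hbridge
  rw [hbridge, NumberField.classNumber, two_dvd_card_classGroup_iff h2 hneg, hdisc,
    Int.natAbs_neg, Int.natAbs_natCast]

/-- For fundamental `−d`: `d` has at most one prime factor iff `d ∈ {4, 8}` or `d` is prime.
[folklore] -/
theorem card_primeFactors_le_one_iff {d : ℕ} (hF : IsNegFundamentalDiscr d) :
    d.primeFactors.card ≤ 1 ↔ d = 4 ∨ d = 8 ∨ d.Prime := by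
  have hd0 := pos_of_isNegFundamentalDiscr hF
  constructor
  · intro h
    have hd1 : 1 < d := by
      rcases hF with ⟨h1, -, h3⟩ | ⟨h4, -, -⟩ <;> omega
    have hcard : d.primeFactors.card = 1 := by
      have : 0 < d.primeFactors.card :=
        Finset.card_pos.2 (Nat.nonempty_primeFactors.2 hd1)
      omega
    obtain ⟨p, k, hp, hk, hpk⟩ :=
      (isPrimePow_iff_card_primeFactors_eq_one.2 hcard)
    have hp' : p.Prime := hp.nat_prime
    rcases hF with ⟨h1, hsq, -⟩ | ⟨h4, hm4, hsq⟩
    · -- odd case: `d = p^k` squarefree, so `k = 1`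
      right; right
      have hsqN : Squarefree (p ^ k) := by
        rw [hpk]; rwa [← Int.squarefree_natAbs, Int.natAbs_neg, Int.natAbs_natCast] at hsq
      rcases Squarefree.eq_zero_or_one_of_pow_of_not_isUnit hsqN
          (fun hu => hp'.one_lt.ne' (Nat.isUnit_iff.1 hu)) with hk0 | hk1
      · omega
      · rw [← hpk, hk1, pow_one]; exact hp'
    · -- even case: `p = 2`, `d = 2^k`, `d/4 = 2^(k-2)` squarefree, so `k ∈ {2, 3}`
      have h4d : 4 ∣ d := by exact_mod_cast (Int.dvd_neg.1 h4)
      have h2p : p = 2 := by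
        have h2d : 2 ∣ p ^ k := hpk ▸ (dvd_trans (by norm_num) h4d)
        exact ((Nat.prime_dvd_prime_iff_eq Nat.prime_two hp').1
          (Nat.prime_two.dvd_of_dvd_pow h2d)).symm
      subst h2p
      have hk2 : 2 ≤ k := by
        by_contra hk2
        interval_cases k
        rw [pow_one] at hpk
        omega
      obtain ⟨j, rfl⟩ : ∃ j, k = j + 2 := ⟨k - 2, by omega⟩
      have hdk : (d : ℤ) = 4 * 2 ^ j := by
        rw [← hpk]; push_cast; rw [pow_add]; ring
      have hdiv : (-(d : ℤ)) / 4 = -(2 ^ j) := by rw [hdk]; omega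
      rw [hdiv] at hsq
      have hsqN : Squarefree ((2 : ℕ) ^ j) := by
        rw [← Int.squarefree_natAbs] at hsq
        have habs : (-((2 : ℤ) ^ j)).natAbs = 2 ^ j := by simp [Int.natAbs_pow]
        rwa [habs] at hsq
      rcases Squarefree.eq_zero_or_one_of_pow_of_not_isUnit hsqN
          (fun hu => absurd (Nat.isUnit_iff.1 hu) (by norm_num)) with hj0 | hj1
      · left; rw [← hpk, hj0]; norm_num
      · right; left; rw [← hpk, hj1]; norm_num
  · rintro (rfl | rfl | hp)
    · rw [show (4 : ℕ) = 2 ^ 2 by norm_num, Nat.primeFactors_prime_pow two_ne_zero Nat.prime_two]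
      simp
    · rw [show (8 : ℕ) = 2 ^ 3 by norm_num, Nat.primeFactors_prime_pow three_ne_zero Nat.prime_two]
      simp
    · rw [hp.primeFactors, Finset.card_singleton]

/-- **Genus theory for the `ℓ = 2` analogue of the crux**: on fundamental `−d`,
`2 ∣ h(−d) ↔ d ∉ {4, 8} ∧ d` not prime. [folklore] -/
theorem two_dvd_classNumber_iff_not {d : ℕ} (hF : IsNegFundamentalDiscr d) :
    2 ∣ BinaryQuadraticForm.classNumber (-(d : ℤ)) ↔ ¬ (d = 4 ∨ d = 8 ∨ d.Prime) := by
  rw [two_dvd_classNumber_iff hF, ← card_primeFactors_le_one_iff hF]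
  omega

/-! ### The `ℓ = 2` language and fundamentality recognition -/

/-- `IQ2`-set `= Fund ∖ ({4, 8} ∪ primes)`. [folklore] -/
theorem iqTwoSet_eq :
    {d : ℕ | IsNegFundamentalDiscr d ∧ 2 ∣ BinaryQuadraticForm.classNumber (-(d : ℤ))} =
      {d : ℕ | IsNegFundamentalDiscr d} \ (({4, 8} : Set ℕ) ∪ {p : ℕ | p.Prime}) := by
  ext d
  simp only [Set.mem_setOf_eq, Set.mem_sdiff, Set.mem_union, Set.mem_insert_iff,
    Set.mem_singleton_iff]
  constructor
  · rintro ⟨hF, h2⟩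
    exact ⟨hF, by have := (two_dvd_classNumber_iff_not hF).1 h2; rwa [or_assoc]⟩
  · rintro ⟨hF, hn⟩
    exact ⟨hF, (two_dvd_classNumber_iff_not hF).2 (by rwa [or_assoc] at hn)⟩

/-- `−4` and `−8` are fundamental. [folklore] -/
theorem isNegFundamentalDiscr_four : IsNegFundamentalDiscr 4 := by
  right; exact ⟨by norm_num, by norm_num, by norm_num⟩

/-- `−8` is fundamental. [folklore] -/
theorem isNegFundamentalDiscr_eight : IsNegFundamentalDiscr 8 := by
  right
  refine ⟨by norm_num, by norm_num, ?_⟩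
  rw [show (-((8 : ℕ) : ℤ)) / 4 = -2 by norm_num]
  exact (Int.prime_iff_natAbs_prime.2 (by norm_num)).squarefree

/-- `Fund = IQ2 ∪ {4, 8} ∪ (primes ≡ 3 (mod 4))`. [folklore] -/
theorem fundSet_eq :
    {d : ℕ | IsNegFundamentalDiscr d} =
      {d : ℕ | IsNegFundamentalDiscr d ∧ 2 ∣ BinaryQuadraticForm.classNumber (-(d : ℤ))} ∪
        (({4, 8} : Set ℕ) ∪ ({p : ℕ | p.Prime} ∩ {n : ℕ | n % 4 = 3})) := by
  rw [iqTwoSet_eq]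
  ext d
  simp only [Set.mem_setOf_eq, Set.mem_sdiff, Set.mem_union, Set.mem_insert_iff,
    Set.mem_singleton_iff, Set.mem_inter_iff]
  constructor
  · intro hF
    by_cases h : d = 4 ∨ d = 8 ∨ d.Prime
    · right
      rcases h with h | h | h
      · left; left; exact h
      · left; right; exact h
      · right; exact ⟨h, mod_four_of_isNegFundamentalDiscr_of_prime hF h⟩
    · left; exact ⟨hF, by rwa [or_assoc]⟩
  · rintro (⟨hF, -⟩ | (rfl | rfl) | ⟨hp, h4⟩)
    · exact hF
    · exact isNegFundamentalDiscr_four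
    · exact isNegFundamentalDiscr_eight
    · exact isNegFundamentalDiscr_of_prime hp h4

end Summit.QuantumAdvantage.QuantumAdvantage.Theorems.IqThreeNotPPoly.Negative

end
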